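import Literature.Topology.FourManifolds.OrientedConnectedSumExistence
import Literature.Topology.FourManifolds.ConnectedSumSphereIdentity
import Literature.Geometry.Manifold.OpenSubmanifoldMFDeriv
import HarnessLib

/-!
# `M # Sⁿ = M` for oriented connected sums (`n ≥ 2`)

Topic `Literature/Topology/FourManifolds`, companion to `ConnectedSumSphereIdentity.lean` (the
standard model `X = α(X ∖ {i₁ 0}) ∪ β(Sⁿ ∖ {-v})` exhibiting a smooth `n`-manifold `X` as the
unoriented connected sum `X # Sⁿ` with `P := X`, `Literature.Topology.FourManifolds.isConnectedSum_sphere_self_holds`) and to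
`OrientedConnectedSumExistence.lean` (orientation calculus for connected sums). This file proves
the ORIENTED sharpening in dimension `n ≥ 2`:

* `Literature.Topology.FourManifolds.isOrientedConnectedSum_sphere_self_of_two_le` — a connected closed oriented smooth
  `n`-manifold `(M, oM)`, `2 ≤ n`, is an oriented connected sum (`Literature.Topology.FourManifolds.IsOrientedConnectedSum`) of
  `(M, oM)` and `(𝕊ⁿ, oS)` with third slot `(M, oM)` itself, for EVERY orientation `oS` of the
  sphere.

This is the case `2 ≤ n` of the named fact `Literature.Topology.FourManifolds.isOrientedConnectedSum_sphere_self`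
(`HomotopySpheresGroup.lean`, leaf (vi) of the decomposition of Kervaire–Milnor's Theorem 1.1,
`Literature.Topology.FourManifolds.exists_commGroup_homotopySphereClass`; that fact is stated for all `n ≠ 0`, and only its
instances `n ≥ 5` are consumed by the group theorem). The case `n = 1` is not treated: the
argument below uses that the punctured pieces `M ∖ {pt}`, `Sⁿ ∖ {pt}` are connected.

## Source

M. Kervaire, J. Milnor, *Groups of homotopy spheres I*, Ann. of Math. 77 (1963), §2, Lemma 2.1,
p. 505: "The sphere `Sⁿ` serves as identity element" (for the connected sum of connected oriented
manifolds, formed with `i₁` orientation preserving and `i₂` orientation reversing); A. Kosinski,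
*Differential Manifolds* (1993), VI.(1.3): `M # Sᵐ = M`.

## Proof

Let `(Φ, v, S₀)` be standard-model data (`Literature.Topology.FourManifolds.ConnectedSumSphereData`: a chart `Φ` of `M` onto
`ℝⁿ`, `i₁ = Φ⁻¹`; a pole `v` and a linear isometry `S₀` of `ℝⁿ`, `i₂ = σᵥ⁻¹ ∘ S₀` a round disc).

1. *Orientation provisos on the discs* (`ConnectedSumSphereData.exists_oriented`): choose the
   constant orientation `o₀` of `ℝⁿ` so that `i₁` preserves `(o₀, oM)` (a disc preserves or
   reverses orientation, `Literature.Topology.FourManifolds.exists_isOrientationPreserving_disc`), and take `S₀` to be the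
   identity or a reflection so that `i₂` reverses `(o₀, oS)`
   (`Literature.Topology.FourManifolds.isOrientationReversing_disc_comp`).
2. *The explicit gluing maps* `jA = ι ∘ α : M ∖ {i₁ 0} → M`, `jB = ι ∘ β : Sⁿ ∖ {-v} → M` (§2) are
   smooth embeddings with open ranges `Uα`, `Uβ` covering `M` and meeting along Kervaire–Milnor's
   relation (`ConnectedSumSphereData.α_eq_β_iff` of the companion file).
3. *`jA` preserves orientation* (§4): `α` is the identity near a point far from the disc (the
   puncture expansion is the identity on `‖y‖ ≥ 3/4`), where its differential is the identity
   (`Literature.Geometry.Manifold.OpenSubmanifold.mfderiv_subtype_val`, re-exported here under a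
   deprecated alias); a diffeomorphism out of a connected manifold which preserves
   orientation at one point preserves orientation
   (`Literature.Topology.FourManifolds.Diffeomorph.isOrientationPreserving_of_orientationAt`, Hirsch §4.4), and `M ∖ {i₁ 0}` is
   connected for `n ≥ 2` (`Literature.Topology.FourManifolds.connectedSpace_puncture_of_isImmersion`).
4. *`jB` preserves orientation* (§3, §4): on the open set `T = i₂ {0 < ‖w‖ < 1}` of the overlap,
   `jB = jA ∘ K` where `K` lifts Kervaire–Milnor's identification `k = i₁ ∘ ψ ∘ e₂`
   (`e₂ = S₀⁻¹ ∘ σᵥ = i₂⁻¹`, `ψ` the disc inversion); `k` carries `oS` to `oM` exactly when its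
   Jacobian is positive (`e₂` carries `oS` to `-o₀`, `ψ` carries `-o₀` to `o₀` as `det dψ < 0`
   by `Literature.Topology.FourManifolds.det_fderiv_discInversionFun_neg`, `i₁` carries `o₀` to `oM`), hence so does `jB` at a
   point of `T`, and the one-point criterion on the connected `Sⁿ ∖ {-v}` concludes.
5. Assembly (§5): `IsOrientedConnectedSum oM oS oM` with witnesses `i₁, i₂, o₀, jA, jB`.

## References

* M. Kervaire, J. Milnor, *Groups of homotopy spheres I*, Ann. of Math. (2) 77 (1963), §2,
  Lemma 2.1, p. 505. [KervaireMilnorAnnals1963] / [KervaireMilnor1963]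
* A. Kosinski, *Differential Manifolds*, Academic Press (1993), Ch. VI §1, (1.3). [Kosinski1993]
* M. W. Hirsch, *Differential Topology*, GTM 33 (1976), Ch. 4 §4, p. 101. [HirschDT1976]
* J. M. Lee, *Introduction to Smooth Manifolds*, 2nd ed. (2013), Example 1.26, Prop. 3.9.
-/

open scoped Manifold ContDiff Topology
open Set Module Function Filter OpenPartialHomeomorph Metric

noncomputable section

namespace Literature.Topology.FourManifolds

/-! ### The inclusion of an open submanifold has identity differential -/

section SubtypeVal

variable {E H : Type*} [NormedAddCommGroup E] [NormedSpace ℝ E] [TopologicalSpace H]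
  {I : ModelWithCorners ℝ E H} {M : Type*} [TopologicalSpace M] [ChartedSpace H M]
  {U : TopologicalSpace.Opens M}

/-- **The inclusion of an open submanifold has identity differential** — moved to the
Mathlib-only file `Literature/Geometry/Manifold/OpenSubmanifoldMFDeriv.lean` as
`Literature.Geometry.Manifold.OpenSubmanifold.hasMFDerivAt_subtype_val` (refactor wi-07965, promote
event 131699); deprecated alias kept for existing users. [folklore] -/
@[deprecated Literature.Geometry.Manifold.OpenSubmanifold.hasMFDerivAt_subtype_val
  (since := "2026-08-15")]
alias hasMFDerivAt_subtype_val := Literature.Geometry.Manifold.OpenSubmanifold.hasMFDerivAt_subtype_val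

/-- The differential of the inclusion of an open submanifold is the identity — moved to
`Literature.Geometry.Manifold.OpenSubmanifold.mfderiv_subtype_val` (refactor wi-07965);
deprecated alias. [folklore] -/
@[deprecated Literature.Geometry.Manifold.OpenSubmanifold.mfderiv_subtype_val
  (since := "2026-08-15")]
alias mfderiv_subtype_val := Literature.Geometry.Manifold.OpenSubmanifold.mfderiv_subtype_val

/-- The inclusion of an open submanifold is differentiable — moved to
`Literature.Geometry.Manifold.OpenSubmanifold.mdifferentiableAt_subtype_val` (refactor wi-07965);
deprecated alias. [folklore] -/
@[deprecated Literature.Geometry.Manifold.OpenSubmanifold.mdifferentiableAt_subtype_val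
  (since := "2026-08-15")]
alias mdifferentiableAt_subtype_val :=
  Literature.Geometry.Manifold.OpenSubmanifold.mdifferentiableAt_subtype_val

/-- The Jacobian determinant of the inclusion of an open submanifold is `1`. [folklore] -/
theorem det_mfderiv_subtype_val (x : U) :
    LinearMap.det (M := E) (mfderiv I I (Subtype.val : U → M) x).toLinearMap = 1 := by
  rw [Literature.Geometry.Manifold.OpenSubmanifold.mfderiv_subtype_val, ContinuousLinearMap.coe_id]
  exact LinearMap.det_id

end SubtypeVal

/-! ### A diffeomorphism preserving orientation at one point preserves orientation -/

section OnePoint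

variable {E H H' : Type*} [NormedAddCommGroup E] [NormedSpace ℝ E] [TopologicalSpace H]
  [TopologicalSpace H'] {I : ModelWithCorners ℝ E H} {I' : ModelWithCorners ℝ E H'}
  {M : Type*} [TopologicalSpace M] [ChartedSpace H M] [IsManifold I 1 M]
  {N : Type*} [TopologicalSpace N] [ChartedSpace H' N] [IsManifold I' 1 N] {m : WithTop ℕ∞}

/-- **A diffeomorphism out of a connected manifold which preserves orientation at one point is
orientation preserving** (Hirsch, *Differential Topology* (1976), §4.4, p. 101: "when `M` is
connected … it suffices to see whether a single `T_x f` preserves orientation";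
`Diffeomorph.isOrientationPreserving_or_isOrientationReversing_holds`). [cite: HirschDT1976, §4.4 p. 101] -/
theorem Diffeomorph.isOrientationPreserving_of_orientationAt [ConnectedSpace M]
    (φ : M ≃ₘ^m⟮I, I'⟯ N) (hm : m ≠ 0) (oM : SmoothOrientation I M) (oN : SmoothOrientation I' N)
    {x : M} (hx : oN (φ x) = oM x ↔ 0 < LinearMap.det (M := E) (mfderiv I I' φ x).toLinearMap) :
    φ.IsOrientationPreserving oM oN := by
  rcases Diffeomorph.isOrientationPreserving_or_isOrientationReversing_holds φ hm oM oN with h | h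
  · exact h
  · exfalso
    have h' : (-oN) (φ x) = oM x ↔
        0 < LinearMap.det (M := E) (mfderiv I I' φ x).toLinearMap := h x
    by_cases hd : 0 < LinearMap.det (M := E) (mfderiv I I' φ x).toLinearMap
    · exact Module.Ray.ne_neg_self (oN (φ x)) ((hx.2 hd).trans (h'.2 hd).symm)
    · have e1 : oN (φ x) ≠ oM x := fun e => hd (hx.1 e)
      have e2 : (-oN) (φ x) ≠ oM x := fun e => hd (h'.1 e)
      rcases orientation_eq_or_eq_neg (oM x) (oN (φ x)) with e | e
      · exact e1 e.symm
      · exact e2 e.symm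

end OnePoint

/-! ### Oriented standard model of `X # Sⁿ = X` -/

namespace ConnectedSumSphereData

variable {V : Type*} [NormedAddCommGroup V] [InnerProductSpace ℝ V] {n : ℕ}
  [Fact (finrank ℝ V = n + 1)] {X : Type*} [TopologicalSpace X] [T2Space X]
  [ChartedSpace (EuclideanSpace ℝ (Fin n)) X] [IsManifold (𝓡 n) ∞ X]
  (D : ConnectedSumSphereData V n X)

/-! #### The explicit gluing maps `jA = ι ∘ α`, `jB = ι ∘ β` -/

/-- The first gluing embedding `jA : X ∖ {i₁ 0} → X`, the diffeomorphism `α` onto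
`X ∖ i₁(B̄(0, 1/8))` followed by the inclusion. [folklore] -/
def jA : ↥(puncture D.i₁) → X := Subtype.val ∘ D.α

/-- The second gluing embedding `jB : S ∖ {i₂ 0} → X`, the diffeomorphism `β` onto `i₁(B(0, 1))`
followed by the inclusion. [folklore] -/
def jB : ↥(puncture D.i₂) → X := Subtype.val ∘ D.β

omit [InnerProductSpace ℝ V] [Fact (finrank ℝ V = n + 1)] [IsManifold (𝓡 n) ∞ X] in
/-- `jA a = α a`. [folklore] -/
theorem jA_apply (a : ↥(puncture D.i₁)) : D.jA a = (D.α a : X) := rfl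

omit [T2Space X] [IsManifold (𝓡 n) ∞ X] in
/-- `jB b = β b`. [folklore] -/
theorem jB_apply (b : ↥(puncture D.i₂)) : D.jB b = (D.β b : X) := rfl

omit [InnerProductSpace ℝ V] [Fact (finrank ℝ V = n + 1)] in
/-- `jA` is a smooth embedding. [folklore] -/
theorem isSmoothEmbedding_jA : Manifold.IsSmoothEmbedding (𝓡 n) (𝓡 n) ∞ D.jA :=
  (Manifold.IsSmoothEmbedding.of_opens D.Uα).comp_diffeomorph D.α

omit [T2Space X] in
/-- `jB` is a smooth embedding. [folklore] -/
theorem isSmoothEmbedding_jB : Manifold.IsSmoothEmbedding (𝓡 n) (𝓡 n) ∞ D.jB :=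
  (Manifold.IsSmoothEmbedding.of_opens D.Uβ).comp_diffeomorph D.β

omit [InnerProductSpace ℝ V] [Fact (finrank ℝ V = n + 1)] [IsManifold (𝓡 n) ∞ X] in
/-- `range jA = Uα`. [folklore] -/
theorem range_jA : range D.jA = (D.Uα : Set X) := by
  have hs : Function.Surjective (D.α : ↥(puncture D.i₁) → ↥D.Uα) := D.α.surjective
  rw [jA, hs.range_comp, Subtype.range_coe_subtype]
  rfl

omit [T2Space X] [IsManifold (𝓡 n) ∞ X] in
/-- `range jB = Uβ`. [folklore] -/
theorem range_jB : range D.jB = (D.Uβ : Set X) := by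
  have hs : Function.Surjective (D.β : ↥(puncture D.i₂) → ↥D.Uβ) := D.β.surjective
  rw [jB, hs.range_comp, Subtype.range_coe_subtype]
  rfl

omit [InnerProductSpace ℝ V] [Fact (finrank ℝ V = n + 1)] [IsManifold (𝓡 n) ∞ X] in
/-- `range jA` is open. [folklore] -/
theorem isOpen_range_jA : IsOpen (range D.jA) := D.range_jA ▸ D.Uα.isOpen

omit [T2Space X] [IsManifold (𝓡 n) ∞ X] in
/-- `range jB` is open. [folklore] -/
theorem isOpen_range_jB : IsOpen (range D.jB) := D.range_jB ▸ D.Uβ.isOpen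

omit [IsManifold (𝓡 n) ∞ X] in
/-- `range jA ∪ range jB = X`. [folklore] -/
theorem range_jA_union_range_jB : range D.jA ∪ range D.jB = univ := by
  rw [range_jA, range_jB]
  exact D.Uα_union_Uβ

omit [IsManifold (𝓡 n) ∞ X] in
/-- The gluing maps meet exactly along Kervaire–Milnor's relation. [cite: KervaireMilnor1963, §2] -/
theorem jA_eq_jB_iff (a : ↥(puncture D.i₁)) (b : ↥(puncture D.i₂)) :
    D.jA a = D.jB b ↔ connectedSumRel D.i₁ D.i₂ a b :=
  D.α_eq_β_iff a b

omit [InnerProductSpace ℝ V] [Fact (finrank ℝ V = n + 1)] in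
/-- `jA` is differentiable. [folklore] -/
theorem mdifferentiableAt_jA (a : ↥(puncture D.i₁)) : MDifferentiableAt (𝓡 n) (𝓡 n) D.jA a :=
  (D.isSmoothEmbedding_jA.contMDiff a).mdifferentiableAt (by simp)

omit [T2Space X] in
/-- `jB` is differentiable. [folklore] -/
theorem mdifferentiableAt_jB (b : ↥(puncture D.i₂)) : MDifferentiableAt (𝓡 n) (𝓡 n) D.jB b :=
  (D.isSmoothEmbedding_jB.contMDiff b).mdifferentiableAt (by simp)

omit [InnerProductSpace ℝ V] [Fact (finrank ℝ V = n + 1)] in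
/-- `jA` has invertible differential. [folklore] -/
theorem det_mfderiv_jA_ne_zero (a : ↥(puncture D.i₁)) :
    LinearMap.det (M := EuclideanSpace ℝ (Fin n)) (mfderiv (𝓡 n) (𝓡 n) D.jA a).toLinearMap ≠ 0 :=
  det_mfderiv_ne_zero_of_isSmoothEmbedding D.isSmoothEmbedding_jA D.isOpen_range_jA a

omit [T2Space X] in
/-- `jB` has invertible differential. [folklore] -/
theorem det_mfderiv_jB_ne_zero (b : ↥(puncture D.i₂)) :
    LinearMap.det (M := EuclideanSpace ℝ (Fin n)) (mfderiv (𝓡 n) (𝓡 n) D.jB b).toLinearMap ≠ 0 :=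
  det_mfderiv_ne_zero_of_isSmoothEmbedding D.isSmoothEmbedding_jB D.isOpen_range_jB b

omit [InnerProductSpace ℝ V] [Fact (finrank ℝ V = n + 1)] in
/-- `d(α) = d(jA)`. [folklore] -/
theorem mfderiv_α (a : ↥(puncture D.i₁)) :
    mfderiv (𝓡 n) (𝓡 n) D.α a = mfderiv (𝓡 n) (𝓡 n) D.jA a :=
  mfderiv_codRestrict_opens_eq (fun _ => rfl) (D.mdifferentiableAt_jA a)

omit [T2Space X] in
/-- `d(β) = d(jB)`. [folklore] -/
theorem mfderiv_β (b : ↥(puncture D.i₂)) :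
    mfderiv (𝓡 n) (𝓡 n) D.β b = mfderiv (𝓡 n) (𝓡 n) D.jB b :=
  mfderiv_codRestrict_opens_eq (fun _ => rfl) (D.mdifferentiableAt_jB b)

/-! #### `jA` is the identity away from the disc -/

omit [InnerProductSpace ℝ V] [Fact (finrank ℝ V = n + 1)] [IsManifold (𝓡 n) ∞ X] in
/-- Away from `i₁(B(0, 3/4))` the map `jA` is the inclusion (the puncture expansion is the
identity on `‖y‖ ≥ 3/4`). [folklore] -/
theorem jA_eq_coe {a : ↥(puncture D.i₁)} (ha : (a : X) ∈ D.Φ.source → 3 / 4 ≤ ‖D.Φ a‖) :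
    D.jA a = a := by
  rw [jA_apply, coe_α]
  by_cases has : (a : X) ∈ D.Φ.source
  · rw [chartTransport_of_mem _ has, punctureExpansion_eq_self (ha has)]
    exact D.Φ.left_inv has
  · exact chartTransport_of_not_mem _ has

omit [InnerProductSpace ℝ V] [Fact (finrank ℝ V = n + 1)] [IsManifold (𝓡 n) ∞ X] in
/-- The open set of the punctured piece away from `i₁(B̄(0, 3/4))`. [folklore] -/
theorem isOpen_far : IsOpen {a : ↥(puncture D.i₁) | (a : X) ∈ D.Φ.source → 3 / 4 < ‖D.Φ a‖} := by
  have hK : IsClosed (D.i₁ '' closedBall (0 : EuclideanSpace ℝ (Fin n)) (3 / 4)) :=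
    ((isCompact_closedBall _ _).image D.continuous_i₁).isClosed
  have heq : {a : ↥(puncture D.i₁) | (a : X) ∈ D.Φ.source → 3 / 4 < ‖D.Φ a‖} =
      Subtype.val ⁻¹' (D.i₁ '' closedBall (0 : EuclideanSpace ℝ (Fin n)) (3 / 4))ᶜ := by
    ext a
    simp only [mem_setOf_eq, mem_preimage, mem_compl_iff, mem_image, mem_closedBall,
      dist_zero_right, not_exists, not_and]
    constructor
    · intro h y hy hya
      have has : (a : X) ∈ D.Φ.source := hya ▸ D.i₁_mem_source y
      have := h has
      rw [← hya, D.Φ_i₁] at this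
      linarith
    · intro h has
      by_contra hlt
      exact h (D.Φ a) (not_lt.mp hlt) (D.i₁_Φ has)
  rw [heq]
  exact hK.isOpen_compl.preimage continuous_subtype_val

omit [InnerProductSpace ℝ V] [Fact (finrank ℝ V = n + 1)] [IsManifold (𝓡 n) ∞ X] in
/-- Near a point away from `i₁(B̄(0, 3/4))`, `jA` is the inclusion. [folklore] -/
theorem jA_eventuallyEq_coe {a : ↥(puncture D.i₁)} (ha : (a : X) ∈ D.Φ.source → 3 / 4 < ‖D.Φ a‖) :
    D.jA =ᶠ[𝓝 a] Subtype.val := by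
  filter_upwards [D.isOpen_far.mem_nhds ha] with a' ha'
  exact D.jA_eq_coe fun h => (ha' h).le

omit [InnerProductSpace ℝ V] [Fact (finrank ℝ V = n + 1)] [IsManifold (𝓡 n) ∞ X] in
/-- At a point away from `i₁(B̄(0, 3/4))` the differential of `jA` is the identity. [folklore] -/
theorem mfderiv_jA_of_far {a : ↥(puncture D.i₁)} (ha : (a : X) ∈ D.Φ.source → 3 / 4 < ‖D.Φ a‖) :
    mfderiv (𝓡 n) (𝓡 n) D.jA a = ContinuousLinearMap.id ℝ (EuclideanSpace ℝ (Fin n)) := by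
  rw [(D.jA_eventuallyEq_coe ha).mfderiv_eq]
  exact Literature.Geometry.Manifold.OpenSubmanifold.mfderiv_subtype_val a

/-- A point of the punctured piece on the unit sphere of the disc (`n ≠ 0`), away from
`i₁(B̄(0, 3/4))`. [folklore] -/
theorem exists_far (hn : n ≠ 0) :
    ∃ a : ↥(puncture D.i₁), ((a : X) ∈ D.Φ.source → 3 / 4 < ‖D.Φ a‖) ∧ D.jA a = a := by
  obtain ⟨m, rfl⟩ := Nat.exists_eq_succ_of_ne_zero hn
  set y : EuclideanSpace ℝ (Fin (m + 1)) := EuclideanSpace.single 0 1 with hy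
  have hy1 : ‖y‖ = 1 := by simp [hy]
  have hy0 : y ≠ 0 := fun h => by simp [h] at hy1
  have ha : D.i₁ y ∈ puncture D.i₁ := fun h => hy0 (D.injective_i₁ h)
  have hfar : (D.i₁ y : X) ∈ D.Φ.source → 3 / 4 < ‖D.Φ (D.i₁ y)‖ := fun _ => by
    rw [D.Φ_i₁, hy1]; norm_num
  exact ⟨⟨D.i₁ y, ha⟩, hfar, D.jA_eq_coe fun h => (hfar h).le⟩

/-! #### The chart `e₂ = S₀⁻¹ ∘ σᵥ` inverse to the round disc, and the identification `k` -/

/-- The inverse `e₂ = S₀⁻¹ ∘ σᵥ : S → ℝⁿ` of the round disc `i₂ = σᵥ⁻¹ ∘ S₀` (on `S ∖ {v}`).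
[folklore] -/
def e₂ (b : sphere (0 : V) 1) : EuclideanSpace ℝ (Fin n) := D.S₀.symm (stereographic' n D.v b)

omit [T2Space X] [IsManifold (𝓡 n) ∞ X] in
/-- `e₂ (i₂ y) = y`. [folklore] -/
@[simp] theorem e₂_i₂ (y : EuclideanSpace ℝ (Fin n)) : D.e₂ (D.i₂ y) = y := by
  rw [e₂, i₂_apply, (stereographic' n D.v).right_inv (by rw [stereographic'_target]; trivial),
    LinearIsometryEquiv.symm_apply_apply]

omit [T2Space X] [IsManifold (𝓡 n) ∞ X] in
/-- `i₂ (e₂ b) = b` for `b ≠ v`. [folklore] -/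
theorem i₂_e₂ {b : sphere (0 : V) 1} (hb : b ∈ (stereographic' n D.v).source) :
    D.i₂ (D.e₂ b) = b := by
  rw [i₂_apply, e₂, LinearIsometryEquiv.apply_symm_apply]
  exact (stereographic' n D.v).left_inv hb

omit [T2Space X] [IsManifold (𝓡 n) ∞ X] in
/-- `i₂ y` lies in the source `S ∖ {v}` of `σᵥ`. [folklore] -/
theorem i₂_mem_source (y : EuclideanSpace ℝ (Fin n)) : D.i₂ y ∈ (stereographic' n D.v).source :=
  (stereographic' n D.v).map_target (by rw [stereographic'_target]; trivial)

omit [T2Space X] [IsManifold (𝓡 n) ∞ X] in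
/-- The range of the round disc is the (open) source of `σᵥ`. [folklore] -/
theorem range_i₂ : range D.i₂ = (stereographic' n D.v).source := by
  refine Subset.antisymm (by rintro _ ⟨y, rfl⟩; exact D.i₂_mem_source y) fun b hb => ?_
  exact ⟨D.e₂ b, D.i₂_e₂ hb⟩

omit [T2Space X] [IsManifold (𝓡 n) ∞ X] in
/-- The range of the round disc is open. [folklore] -/
theorem isOpen_range_i₂ : IsOpen (range D.i₂) := D.range_i₂ ▸ (stereographic' n D.v).open_source

omit [T2Space X] [IsManifold (𝓡 n) ∞ X] in
/-- `e₂` is differentiable on the source of `σᵥ`. [folklore] -/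
theorem mdifferentiableAt_e₂ {b : sphere (0 : V) 1} (hb : b ∈ (stereographic' n D.v).source) :
    MDifferentiableAt (𝓡 n) (𝓡 n) D.e₂ b := by
  have hb' : b ∈ ({D.v}ᶜ : Set (sphere (0 : V) 1)) := by rwa [stereographic'_source] at hb
  have h1 : MDifferentiableAt (𝓡 n) (𝓡 n) (stereographic' n D.v) b :=
    ((contMDiffOn_stereographic' D.v).contMDiffAt
      (isOpen_compl_singleton.mem_nhds hb')).mdifferentiableAt (by simp)
  have h2 : MDifferentiableAt (𝓡 n) (𝓡 n) (D.S₀.symm : EuclideanSpace ℝ (Fin n) → _)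
      (stereographic' n D.v b) :=
    ((((D.S₀.symm : EuclideanSpace ℝ (Fin n) →L[ℝ] EuclideanSpace ℝ (Fin n)).contDiff
      (n := (∞ : WithTop ℕ∞))).contMDiff _).mdifferentiableAt (by simp))
  exact h2.comp b h1

omit [T2Space X] [IsManifold (𝓡 n) ∞ X] in
/-- The round disc is differentiable. [folklore] -/
theorem mdifferentiableAt_i₂ (y : EuclideanSpace ℝ (Fin n)) : MDifferentiableAt (𝓡 n) (𝓡 n) D.i₂ y :=
  (D.isSmoothEmbedding_i₂.contMDiff y).mdifferentiableAt (by simp)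

omit [InnerProductSpace ℝ V] [Fact (finrank ℝ V = n + 1)] [T2Space X] [IsManifold (𝓡 n) ∞ X] in
/-- The first disc is differentiable. [folklore] -/
theorem mdifferentiableAt_i₁ (y : EuclideanSpace ℝ (Fin n)) : MDifferentiableAt (𝓡 n) (𝓡 n) D.i₁ y :=
  (D.contMDiff_i₁ y).mdifferentiableAt (by simp)

omit [T2Space X] [IsManifold (𝓡 n) ∞ X] in
/-- `d(e₂)_{i₂ y} ∘ d(i₂)_y = id`: the Jacobians multiply to `1`. [folklore] -/
theorem det_mfderiv_e₂_mul (y : EuclideanSpace ℝ (Fin n)) :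
    LinearMap.det (M := EuclideanSpace ℝ (Fin n)) (mfderiv (𝓡 n) (𝓡 n) D.e₂ (D.i₂ y)).toLinearMap *
      LinearMap.det (M := EuclideanSpace ℝ (Fin n)) (mfderiv (𝓡 n) (𝓡 n) D.i₂ y).toLinearMap = 1 := by
  apply det_mul_det_eq_one_of_comp_eq_id
  have hid : D.e₂ ∘ D.i₂ = id := funext fun y => D.e₂_i₂ y
  have h := mfderiv_comp y (I := 𝓡 n) (I' := 𝓡 n) (I'' := 𝓡 n)
    (D.mdifferentiableAt_e₂ (D.i₂_mem_source y)) (D.mdifferentiableAt_i₂ y)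
  rw [hid, mfderiv_id] at h
  exact h.symm

omit [T2Space X] [IsManifold (𝓡 n) ∞ X] in
/-- **`e₂` carries `oS` to the constant orientation `-o₀`** at points of the disc when `i₂`
reverses the orientations `(o₀, oS)` (inverse Jacobians have the same sign). [folklore] -/
theorem orientationAt_e₂ {o₀ : Orientation ℝ (EuclideanSpace ℝ (Fin n)) (Fin (finrank ℝ (EuclideanSpace ℝ (Fin n))))}
    {oS : SmoothOrientation (𝓡 n) (sphere (0 : V) 1)}
    (h₂ : IsOrientationReversing (SmoothOrientation.modelSpace o₀) oS D.i₂)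
    (y : EuclideanSpace ℝ (Fin n)) :
    (SmoothOrientation.modelSpace (-o₀) (D.e₂ (D.i₂ y)) = oS (D.i₂ y) ↔
      0 < LinearMap.det (M := EuclideanSpace ℝ (Fin n))
        (mfderiv (𝓡 n) (𝓡 n) D.e₂ (D.i₂ y)).toLinearMap) := by
  have hmul := D.det_mfderiv_e₂_mul y
  have ha0 := left_ne_zero_of_mul_eq_one hmul
  have hb0 := right_ne_zero_of_mul_eq_one hmul
  have hsign := (mul_pos_iff_pos_iff_pos ha0 hb0).mp (by rw [hmul]; exact one_pos)
  have h : (-oS) (D.i₂ y) = SmoothOrientation.modelSpace o₀ y ↔ 0 < LinearMap.det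
      (M := EuclideanSpace ℝ (Fin n)) (mfderiv (𝓡 n) (𝓡 n) D.i₂ y).toLinearMap := h₂ y
  simp only [SmoothOrientation.modelSpace_apply] at h ⊢
  rw [hsign, ← h]
  constructor
  · intro e
    show -oS (D.i₂ y) = o₀
    rw [← e]
    exact _root_.neg_neg o₀
  · intro e
    have e' : -oS (D.i₂ y) = o₀ := e
    rw [← e']
    exact _root_.neg_neg (oS (D.i₂ y))

/-- Kervaire–Milnor's identification read as a map of the sphere: `k = i₁ ∘ ψ ∘ e₂`
(`ψ` the disc inversion), which sends the point `i₂ ((1 - t) u)` of the second disc to the related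
point `i₁ (t u)` of the first. [cite: KervaireMilnor1963, §2] -/
def k : sphere (0 : V) 1 → X := D.i₁ ∘ ((discInversionFun : EuclideanSpace ℝ (Fin n) → _) ∘ D.e₂)

omit [T2Space X] [IsManifold (𝓡 n) ∞ X] in
/-- `k (i₂ w) = i₁ (ψ w)`. [folklore] -/
theorem k_i₂ (w : EuclideanSpace ℝ (Fin n)) : D.k (D.i₂ w) = D.i₁ (discInversionFun w) := by
  simp [k]

omit [IsManifold (𝓡 n) ∞ X] in
/-- `jB (i₂ w) = jA (i₁ (ψ w))` for `0 < ‖w‖ < 1`: the two gluing maps agree along the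
identification (`α_eq_β_iff`). [cite: KervaireMilnor1963, §2] -/
theorem jB_eq_jA {w : EuclideanSpace ℝ (Fin n)} (hw0 : 0 < ‖w‖) (hw1 : ‖w‖ < 1)
    (hb : D.i₂ w ∈ puncture D.i₂) (ha : D.i₁ (discInversionFun w) ∈ puncture D.i₁) :
    D.jB ⟨D.i₂ w, hb⟩ = D.jA ⟨D.i₁ (discInversionFun w), ha⟩ := by
  symm
  rw [D.jA_eq_jB_iff]
  set s : ℝ := ‖w‖ with hs
  set u : EuclideanSpace ℝ (Fin n) := s⁻¹ • w with hu
  have hu1 : ‖u‖ = 1 := by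
    rw [hu, norm_smul, norm_inv, Real.norm_of_nonneg hw0.le, inv_mul_cancel₀ hw0.ne']
  have hwu : w = s • u := by rw [hu, smul_smul, mul_inv_cancel₀ hw0.ne', one_smul]
  refine ⟨u, 1 - s, hu1, ⟨by linarith, by linarith⟩, ?_, ?_⟩
  · show D.i₁ (discInversionFun w) = D.i₁ ((1 - s) • u)
    rw [hwu, discInversionFun_smul hu1 hw0]
  · show D.i₂ w = D.i₂ ((1 - (1 - s)) • u)
    rw [sub_sub_cancel, ← hwu]

omit [InnerProductSpace ℝ V] [Fact (finrank ℝ V = n + 1)] [IsManifold (𝓡 n) ∞ X] in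
/-- `ψ w ≠ 0` (so `i₁ (ψ w)` lies in the punctured piece) for `0 < ‖w‖ < 1`. [folklore] -/
theorem i₁_discInversionFun_mem {w : EuclideanSpace ℝ (Fin n)} (hw0 : 0 < ‖w‖) (hw1 : ‖w‖ < 1) :
    D.i₁ (discInversionFun w) ∈ puncture D.i₁ := by
  intro h
  have h0 : discInversionFun w = 0 := D.injective_i₁ h
  have h1 := norm_discInversionFun (norm_pos_iff.1 hw0) hw1.le
  rw [h0, norm_zero] at h1
  linarith

omit [T2Space X] [IsManifold (𝓡 n) ∞ X] in
/-- `i₂ w` lies in the punctured piece `S ∖ {i₂ 0}` for `w ≠ 0`. [folklore] -/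
theorem i₂_mem_puncture {w : EuclideanSpace ℝ (Fin n)} (hw : w ≠ 0) : D.i₂ w ∈ puncture D.i₂ :=
  fun h => hw (D.injective_i₂ h)

/-- The open set of the second punctured piece glued onto the first disc: the points `b` with
`0 < ‖e₂ b‖ < 1`. [folklore] -/
def T : Set ↥(puncture D.i₂) :=
  Subtype.val ⁻¹' ((stereographic' n D.v).source ∩
    stereographic' n D.v ⁻¹' (D.S₀.symm ⁻¹' {w | 0 < ‖w‖ ∧ ‖w‖ < 1}))

omit [T2Space X] [IsManifold (𝓡 n) ∞ X] in
/-- `T` is open. [folklore] -/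
theorem isOpen_T : IsOpen D.T := by
  refine ((stereographic' n D.v).isOpen_inter_preimage ?_).preimage continuous_subtype_val
  have ho : IsOpen {w : EuclideanSpace ℝ (Fin n) | 0 < ‖w‖ ∧ ‖w‖ < 1} := by
    have : {w : EuclideanSpace ℝ (Fin n) | 0 < ‖w‖ ∧ ‖w‖ < 1} = (‖·‖) ⁻¹' Ioo 0 1 := rfl
    rw [this]
    exact isOpen_Ioo.preimage continuous_norm
  exact ho.preimage D.S₀.symm.continuous

omit [T2Space X] [IsManifold (𝓡 n) ∞ X] in
/-- Points of `T` are `i₂ w` with `w = e₂ b`, `0 < ‖w‖ < 1`. [folklore] -/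
theorem mem_T {b : ↥(puncture D.i₂)} (hb : b ∈ D.T) :
    (b : sphere (0 : V) 1) ∈ (stereographic' n D.v).source ∧ 0 < ‖D.e₂ b‖ ∧ ‖D.e₂ b‖ < 1 :=
  ⟨hb.1, hb.2⟩

omit [T2Space X] [IsManifold (𝓡 n) ∞ X] in
/-- `i₂ w ∈ T` for `0 < ‖w‖ < 1`. [folklore] -/
theorem i₂_mem_T {w : EuclideanSpace ℝ (Fin n)} (hw0 : 0 < ‖w‖) (hw1 : ‖w‖ < 1)
    (hb : D.i₂ w ∈ puncture D.i₂) : (⟨D.i₂ w, hb⟩ : ↥(puncture D.i₂)) ∈ D.T := by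
  refine ⟨D.i₂_mem_source w, ?_⟩
  show stereographic' n D.v (D.i₂ w) ∈ D.S₀.symm ⁻¹' {w | 0 < ‖w‖ ∧ ‖w‖ < 1}
  rw [mem_preimage]
  have : D.S₀.symm (stereographic' n D.v (D.i₂ w)) = w := D.e₂_i₂ w
  rw [this]
  exact ⟨hw0, hw1⟩

/-- The lift `K : S ∖ {i₂ 0} → X ∖ {i₁ 0}` of `k` (well defined on `T`, extended by a constant).
[folklore] -/
def K (a₀ : ↥(puncture D.i₁)) (b : ↥(puncture D.i₂)) : ↥(puncture D.i₁) := by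
  classical
  exact if h : D.k b ∈ puncture D.i₁ then ⟨D.k b, h⟩ else a₀

omit [IsManifold (𝓡 n) ∞ X] in
/-- On `T`, `↑(K b) = k b`. [folklore] -/
theorem coe_K {a₀ : ↥(puncture D.i₁)} {b : ↥(puncture D.i₂)} (hb : b ∈ D.T) :
    ((D.K a₀ b : ↥(puncture D.i₁)) : X) = D.k b := by
  classical
  obtain ⟨hbs, h0, h1⟩ := D.mem_T hb
  have hmem : D.k b ∈ puncture D.i₁ := by
    have := D.i₁_discInversionFun_mem h0 h1
    simpa [k] using this
  simp only [K, hmem, dif_pos]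

omit [IsManifold (𝓡 n) ∞ X] in
/-- On `T`, `jB = jA ∘ K`. [cite: KervaireMilnor1963, §2] -/
theorem jB_eq_jA_K {a₀ : ↥(puncture D.i₁)} {b : ↥(puncture D.i₂)} (hb : b ∈ D.T) :
    D.jB b = D.jA (D.K a₀ b) := by
  obtain ⟨hbs, h0, h1⟩ := D.mem_T hb
  have hbw : D.i₂ (D.e₂ b) = b := D.i₂_e₂ hbs
  have hb' : D.i₂ (D.e₂ b) ∈ puncture D.i₂ := hbw.symm ▸ b.2
  have hKb : D.K a₀ b = ⟨D.i₁ (discInversionFun (D.e₂ b)), D.i₁_discInversionFun_mem h0 h1⟩ :=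
    Subtype.ext (by rw [D.coe_K hb]; rfl)
  have hbb : b = ⟨D.i₂ (D.e₂ b), hb'⟩ := Subtype.ext hbw.symm
  rw [hKb]
  conv_lhs => rw [hbb]
  exact D.jB_eq_jA h0 h1 hb' _

/-! #### The identification `k` preserves orientation -/

omit [T2Space X] in
/-- **`k = i₁ ∘ ψ ∘ e₂` carries `oS b` to `oX (k b)` exactly when `det dk_b > 0`**, at the
points `b = i₂ w`, `0 < ‖w‖ < 1`, for `i₁` preserving and `i₂` reversing the orientations
`(o₀, ·)`: `e₂` then carries `oS` to `-o₀`, the inversion `ψ` carries `-o₀` to `o₀`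
(`det dψ < 0`), and `i₁` carries `o₀` to `oX` (Kervaire–Milnor 1963, §2). [cite: KervaireMilnor1963, §2] -/
theorem orientationAt_k (hn : n ≠ 0)
    {o₀ : Orientation ℝ (EuclideanSpace ℝ (Fin n)) (Fin (finrank ℝ (EuclideanSpace ℝ (Fin n))))}
    {oX : SmoothOrientation (𝓡 n) X} {oS : SmoothOrientation (𝓡 n) (sphere (0 : V) 1)}
    (h₁ : IsOrientationPreserving (SmoothOrientation.modelSpace o₀) oX D.i₁)
    (h₂ : IsOrientationReversing (SmoothOrientation.modelSpace o₀) oS D.i₂)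
    {w : EuclideanSpace ℝ (Fin n)} (hw0 : 0 < ‖w‖) (hw1 : ‖w‖ < 1) :
    (oX (D.k (D.i₂ w)) = oS (D.i₂ w) ↔ 0 < LinearMap.det (M := EuclideanSpace ℝ (Fin n))
      (mfderiv (𝓡 n) (𝓡 n) D.k (D.i₂ w)).toLinearMap) ∧
    MDifferentiableAt (𝓡 n) (𝓡 n) D.k (D.i₂ w) ∧
    LinearMap.det (M := EuclideanSpace ℝ (Fin n))
      (mfderiv (𝓡 n) (𝓡 n) D.k (D.i₂ w)).toLinearMap ≠ 0 := by
  set b := D.i₂ w with hb_def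
  have hwb : D.e₂ b = w := D.e₂_i₂ w
  have hw : w ≠ 0 := norm_pos_iff.1 hw0
  -- `e₂` at `b`
  have he := D.orientationAt_e₂ h₂ w
  have hed := D.mdifferentiableAt_e₂ (D.i₂_mem_source w)
  have he0 := left_ne_zero_of_mul_eq_one (D.det_mfderiv_e₂_mul w)
  -- `ψ` at `w`
  have hψd : MDifferentiableAt (𝓡 n) (𝓡 n) (discInversionFun : EuclideanSpace ℝ (Fin n) → _) w :=
    ((contDiffAt_discInversionFun hw).differentiableAt (by simp)).mdifferentiableAt
  have hψdet : LinearMap.det (M := EuclideanSpace ℝ (Fin n)) (mfderiv (𝓡 n) (𝓡 n)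
      (discInversionFun : EuclideanSpace ℝ (Fin n) → _) w).toLinearMap < 0 := by
    rw [mfderiv_eq_fderiv]
    exact det_fderiv_discInversionFun_neg hn hw0 hw1
  have hψ : (SmoothOrientation.modelSpace o₀ (discInversionFun w) =
      SmoothOrientation.modelSpace (-o₀) w ↔ 0 < LinearMap.det (M := EuclideanSpace ℝ (Fin n))
        (mfderiv (𝓡 n) (𝓡 n) (discInversionFun : EuclideanSpace ℝ (Fin n) → _) w).toLinearMap) := by
    simp only [SmoothOrientation.modelSpace_apply]
    exact iff_of_false (Module.Ray.ne_neg_self o₀) (lt_asymm hψdet)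
  -- `ψ ∘ e₂` at `b`
  rw [← hwb] at hψd hψ hψdet
  have hc1 := orientationAt_comp (oM := oS) (oN := SmoothOrientation.modelSpace (-o₀))
    (oP := SmoothOrientation.modelSpace o₀) (f := D.e₂) (g := discInversionFun) (x := b)
    hed hψd he0 hψdet.ne he hψ
  have hc1d : MDifferentiableAt (𝓡 n) (𝓡 n) ((discInversionFun : EuclideanSpace ℝ (Fin n) → _) ∘
      D.e₂) b := hψd.comp b hed
  have hc10 : LinearMap.det (M := EuclideanSpace ℝ (Fin n)) (mfderiv (𝓡 n) (𝓡 n)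
      ((discInversionFun : EuclideanSpace ℝ (Fin n) → _) ∘ D.e₂) b).toLinearMap ≠ 0 := by
    have hcomp : mfderiv (𝓡 n) (𝓡 n) ((discInversionFun : EuclideanSpace ℝ (Fin n) → _) ∘ D.e₂) b =
        (mfderiv (𝓡 n) (𝓡 n) (discInversionFun : EuclideanSpace ℝ (Fin n) → _) (D.e₂ b)).comp
          (mfderiv (𝓡 n) (𝓡 n) D.e₂ b) := mfderiv_comp b hψd hed
    rw [hcomp]
    have hdet' : LinearMap.det (M := EuclideanSpace ℝ (Fin n))
        ((mfderiv (𝓡 n) (𝓡 n) (discInversionFun : EuclideanSpace ℝ (Fin n) → _) (D.e₂ b)).comp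
          (mfderiv (𝓡 n) (𝓡 n) D.e₂ b)).toLinearMap =
        LinearMap.det (M := EuclideanSpace ℝ (Fin n))
          (mfderiv (𝓡 n) (𝓡 n) (discInversionFun : EuclideanSpace ℝ (Fin n) → _) (D.e₂ b)).toLinearMap *
          LinearMap.det (M := EuclideanSpace ℝ (Fin n)) (mfderiv (𝓡 n) (𝓡 n) D.e₂ b).toLinearMap :=
      LinearMap.det_comp (M := EuclideanSpace ℝ (Fin n)) _ _
    rw [hdet']
    exact mul_ne_zero hψdet.ne he0
  -- `i₁` at `ψ (e₂ b)`
  have hi₁d := D.mdifferentiableAt_i₁ (discInversionFun (D.e₂ b))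
  have hi₁0 := det_mfderiv_ne_zero_of_isSmoothEmbedding D.isSmoothEmbedding_i₁
    (D.source_eq ▸ D.Φ.open_source) (discInversionFun (D.e₂ b))
  have hc2 := orientationAt_comp (oM := oS) (oN := SmoothOrientation.modelSpace o₀) (oP := oX)
    (f := (discInversionFun : EuclideanSpace ℝ (Fin n) → _) ∘ D.e₂) (g := D.i₁) (x := b)
    hc1d hi₁d hc10 hi₁0 hc1 (h₁ (discInversionFun (D.e₂ b)))
  have hkd : MDifferentiableAt (𝓡 n) (𝓡 n) D.k b := hi₁d.comp b hc1d
  refine ⟨hc2, hkd, ?_⟩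
  have hcomp : mfderiv (𝓡 n) (𝓡 n) D.k b = (mfderiv (𝓡 n) (𝓡 n) D.i₁
      (((discInversionFun : EuclideanSpace ℝ (Fin n) → _) ∘ D.e₂) b)).comp
        (mfderiv (𝓡 n) (𝓡 n) ((discInversionFun : EuclideanSpace ℝ (Fin n) → _) ∘ D.e₂) b) :=
    mfderiv_comp b hi₁d hc1d
  rw [hcomp]
  have hdet' : LinearMap.det (M := EuclideanSpace ℝ (Fin n)) ((mfderiv (𝓡 n) (𝓡 n) D.i₁
      (((discInversionFun : EuclideanSpace ℝ (Fin n) → _) ∘ D.e₂) b)).comp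
        (mfderiv (𝓡 n) (𝓡 n) ((discInversionFun : EuclideanSpace ℝ (Fin n) → _) ∘ D.e₂) b)).toLinearMap =
      LinearMap.det (M := EuclideanSpace ℝ (Fin n)) (mfderiv (𝓡 n) (𝓡 n) D.i₁
        (((discInversionFun : EuclideanSpace ℝ (Fin n) → _) ∘ D.e₂) b)).toLinearMap *
        LinearMap.det (M := EuclideanSpace ℝ (Fin n)) (mfderiv (𝓡 n) (𝓡 n)
          ((discInversionFun : EuclideanSpace ℝ (Fin n) → _) ∘ D.e₂) b).toLinearMap :=
    LinearMap.det_comp (M := EuclideanSpace ℝ (Fin n)) _ _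
  rw [hdet']
  exact mul_ne_zero hi₁0 hc10

end ConnectedSumSphereData

/-- The unit sphere of an inner product space of dimension `n + 1 ≥ 2` is connected. [folklore] -/
theorem connectedSpace_unitSphere {V : Type*} [NormedAddCommGroup V] [InnerProductSpace ℝ V] {n : ℕ}
    [Fact (finrank ℝ V = n + 1)] (hn : n ≠ 0) : ConnectedSpace (sphere (0 : V) 1) := by
  have hV : finrank ℝ V = n + 1 := Fact.out
  haveI : FiniteDimensional ℝ V := Module.finite_of_finrank_pos (by omega)
  refine isConnected_iff_connectedSpace.mp (isConnected_sphere ?_ 0 zero_le_one)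
  rw [← Module.finrank_eq_rank, hV]
  exact Nat.one_lt_cast.mpr (by omega)

namespace ConnectedSumSphereData

variable {V : Type*} [NormedAddCommGroup V] [InnerProductSpace ℝ V] {n : ℕ}
  [Fact (finrank ℝ V = n + 1)] {X : Type*} [TopologicalSpace X] [T2Space X]
  [ChartedSpace (EuclideanSpace ℝ (Fin n)) X] [IsManifold (𝓡 n) ∞ X]
  (D : ConnectedSumSphereData V n X)

/-! #### The punctured pieces are connected (`n ≥ 2`) -/

omit [InnerProductSpace ℝ V] [Fact (finrank ℝ V = n + 1)] in
/-- `X ∖ {i₁ 0}` is connected for connected `X` and `n ≥ 2`. [cite: Kosinski1993, Ch. VI, Thm 1.1] -/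
theorem connectedSpace_punctureA [ConnectedSpace X] (h2 : 2 ≤ n) :
    ConnectedSpace ↥(puncture D.i₁) :=
  connectedSpace_puncture_of_isImmersion (IM := 𝓡 n) (IP := 𝓡 n)
    (D.isSmoothEmbedding_i₁ : Manifold.IsSmoothEmbedding 𝓘(ℝ, EuclideanSpace ℝ (Fin n)) (𝓡 n) ∞
      D.i₁) D.isSmoothEmbedding_jA.isImmersion (by rw [finrank_euclideanSpace_fin]; omega)

omit [T2Space X] in
/-- `S ∖ {i₂ 0}` is connected for `n ≥ 2`. [cite: Kosinski1993, Ch. VI, Thm 1.1] -/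
theorem connectedSpace_punctureB (h2 : 2 ≤ n) : ConnectedSpace ↥(puncture D.i₂) := by
  haveI : ConnectedSpace (sphere (0 : V) 1) := connectedSpace_unitSphere (n := n) (by omega)
  exact connectedSpace_puncture_of_isImmersion (IM := 𝓡 n) (IP := 𝓡 n)
    (D.isSmoothEmbedding_i₂ : Manifold.IsSmoothEmbedding 𝓘(ℝ, EuclideanSpace ℝ (Fin n)) (𝓡 n) ∞
      D.i₂) D.isSmoothEmbedding_jB.isImmersion (by rw [finrank_euclideanSpace_fin]; omega)

/-! #### `α` and `jA` preserve orientation -/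

/-- **`α : X ∖ {i₁ 0} ≅ X ∖ i₁(B̄(0, 1/8))` is orientation preserving** (for the restrictions of
any orientation of `X`, `X` connected, `n ≥ 2`): it is the identity near a point far from the
disc, and a diffeomorphism out of a connected manifold preserving orientation at one point
preserves orientation (Hirsch §4.4). [cite: HirschDT1976, §4.4 p. 101] -/
theorem isOrientationPreserving_α [ConnectedSpace X] (h2 : 2 ≤ n) (oX : SmoothOrientation (𝓡 n) X) :
    D.α.IsOrientationPreserving (oX.restrict (puncture D.i₁)) (oX.restrict D.Uα) := by
  haveI := D.connectedSpace_punctureA h2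
  obtain ⟨a, hfar, hfix⟩ := D.exists_far (by omega)
  refine Diffeomorph.isOrientationPreserving_of_orientationAt D.α (by simp) _ _ (x := a) ?_
  rw [D.mfderiv_α, D.mfderiv_jA_of_far hfar, ContinuousLinearMap.coe_id]
  simp only [SmoothOrientation.restrict_apply]
  have ha : ((D.α a : ↥D.Uα) : X) = a := hfix
  rw [ha]
  exact iff_of_true rfl (lt_of_lt_of_eq one_pos LinearMap.det_id.symm)

/-- **`jA : (X ∖ {i₁ 0}, oX|) → (X, oX)` is orientation preserving** (`X` connected, `n ≥ 2`).
[cite: HirschDT1976, §4.4 p. 101] -/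
theorem isOrientationPreserving_jA [ConnectedSpace X] (h2 : 2 ≤ n)
    (oX : SmoothOrientation (𝓡 n) X) :
    IsOrientationPreserving (oX.restrict (puncture D.i₁)) oX D.jA := by
  intro a
  have h := D.isOrientationPreserving_α h2 oX a
  rw [D.mfderiv_α] at h
  exact h

/-! #### `β` and `jB` preserve orientation -/

/-- **`β : S ∖ {-v} ≅ i₁(B(0, 1))` is orientation preserving** from `oS|` to `oX|`, when `i₁`
preserves and `i₂` reverses the orientations `(o₀, ·)` (`X` connected, `n ≥ 2`): at a point
`b₀ = i₂ w₀` of the overlap, `jB = jA ∘ K` near `b₀` with the identification `K` (a lift of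
`k = i₁ ∘ ψ ∘ e₂`) orientation preserving at `b₀` (`orientationAt_k`) and `jA` orientation
preserving; conclude by Hirsch's one-point criterion on the connected `S ∖ {-v}`.
[cite: KervaireMilnor1963, §2] -/
theorem isOrientationPreserving_β [ConnectedSpace X] (h2 : 2 ≤ n)
    {o₀ : Orientation ℝ (EuclideanSpace ℝ (Fin n)) (Fin (finrank ℝ (EuclideanSpace ℝ (Fin n))))}
    {oX : SmoothOrientation (𝓡 n) X} {oS : SmoothOrientation (𝓡 n) (sphere (0 : V) 1)}
    (h₁ : IsOrientationPreserving (SmoothOrientation.modelSpace o₀) oX D.i₁)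
    (h₂ : IsOrientationReversing (SmoothOrientation.modelSpace o₀) oS D.i₂) :
    D.β.IsOrientationPreserving (oS.restrict (puncture D.i₂)) (oX.restrict D.Uβ) := by
  haveI := D.connectedSpace_punctureB h2
  haveI : Nontrivial (EuclideanSpace ℝ (Fin n)) :=
    Module.nontrivial_of_finrank_pos (R := ℝ) (by rw [finrank_euclideanSpace_fin]; omega)
  obtain ⟨w₀, hw₀⟩ := exists_norm_eq (EuclideanSpace ℝ (Fin n)) (show (0 : ℝ) ≤ 1 / 2 by norm_num)
  have hw0 : 0 < ‖w₀‖ := by rw [hw₀]; norm_num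
  have hw1 : ‖w₀‖ < 1 := by rw [hw₀]; norm_num
  have hb₀ : D.i₂ w₀ ∈ puncture D.i₂ := D.i₂_mem_puncture (norm_pos_iff.1 hw0)
  set b₀ : ↥(puncture D.i₂) := ⟨D.i₂ w₀, hb₀⟩ with hb₀_def
  refine Diffeomorph.isOrientationPreserving_of_orientationAt D.β (by simp) _ _ (x := b₀) ?_
  rw [D.mfderiv_β]
  simp only [SmoothOrientation.restrict_apply]
  show (oX (D.jB b₀) = oS (D.i₂ w₀) ↔ _)
  have hT : b₀ ∈ D.T := D.i₂_mem_T hw0 hw1 hb₀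
  obtain ⟨a₁, -, -⟩ := D.exists_far (by omega)
  have hev : D.jB =ᶠ[𝓝 b₀] D.jA ∘ D.K a₁ := by
    filter_upwards [D.isOpen_T.mem_nhds hT] with b hb
    exact D.jB_eq_jA_K hb
  have hKev : ∀ᶠ b in 𝓝 b₀, ((D.K a₁ b : ↥(puncture D.i₁)) : X) = D.k b := by
    filter_upwards [D.isOpen_T.mem_nhds hT] with b hb
    exact D.coe_K hb
  obtain ⟨hk, hkd, hk0⟩ := D.orientationAt_k (by omega) h₁ h₂ hw0 hw1
  have hKd : MDifferentiableAt (𝓡 n) (𝓡 n) (D.K a₁) b₀ :=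
    mdifferentiableAt_opens_of_eventuallyEq hKev hkd
  have hKderiv : mfderiv (𝓡 n) (𝓡 n) (D.K a₁) b₀ = mfderiv (𝓡 n) (𝓡 n) D.k (D.i₂ w₀) :=
    mfderiv_opens_eq_of_eventuallyEq hKev hkd
  have hKb₀ : ((D.K a₁ b₀ : ↥(puncture D.i₁)) : X) = D.k (D.i₂ w₀) := D.coe_K hT
  have hK : ((oX.restrict (puncture D.i₁)) (D.K a₁ b₀) = (oS.restrict (puncture D.i₂)) b₀ ↔
      0 < LinearMap.det (M := EuclideanSpace ℝ (Fin n))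
        (mfderiv (𝓡 n) (𝓡 n) (D.K a₁) b₀).toLinearMap) := by
    simp only [SmoothOrientation.restrict_apply]
    rw [hKb₀, hKderiv]
    exact hk
  have hK0 : LinearMap.det (M := EuclideanSpace ℝ (Fin n))
      (mfderiv (𝓡 n) (𝓡 n) (D.K a₁) b₀).toLinearMap ≠ 0 := by
    rw [hKderiv]; exact hk0
  have hjA := D.isOrientationPreserving_jA h2 oX (D.K a₁ b₀)
  have hcomp := orientationAt_comp (oM := oS.restrict (puncture D.i₂))
    (oN := oX.restrict (puncture D.i₁)) (oP := oX) (f := D.K a₁) (g := D.jA) (x := b₀) hKd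
    (D.mdifferentiableAt_jA _) hK0 (D.det_mfderiv_jA_ne_zero _) hK hjA
  rw [hev.mfderiv_eq]
  have hval : D.jB b₀ = D.jA (D.K a₁ b₀) := D.jB_eq_jA_K hT
  rw [hval]
  simp only [SmoothOrientation.restrict_apply] at hcomp
  exact hcomp

/-- **`jB : (S ∖ {-v}, oS|) → (X, oX)` is orientation preserving** (`X` connected, `n ≥ 2`, `i₁`
preserving and `i₂` reversing `(o₀, ·)`). [cite: KervaireMilnor1963, §2] -/
theorem isOrientationPreserving_jB [ConnectedSpace X] (h2 : 2 ≤ n)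
    {o₀ : Orientation ℝ (EuclideanSpace ℝ (Fin n)) (Fin (finrank ℝ (EuclideanSpace ℝ (Fin n))))}
    {oX : SmoothOrientation (𝓡 n) X} {oS : SmoothOrientation (𝓡 n) (sphere (0 : V) 1)}
    (h₁ : IsOrientationPreserving (SmoothOrientation.modelSpace o₀) oX D.i₁)
    (h₂ : IsOrientationReversing (SmoothOrientation.modelSpace o₀) oS D.i₂) :
    IsOrientationPreserving (oS.restrict (puncture D.i₂)) oX D.jB := by
  intro b
  have h := D.isOrientationPreserving_β h2 h₁ h₂ b
  rw [D.mfderiv_β] at h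
  exact h

/-! #### The oriented standard model -/

/-- **`(X, oX)` is the oriented connected sum of itself and `(S, oS)`** along the discs
`i₁ = Φ⁻¹`, `i₂ = σᵥ⁻¹ ∘ S₀`, whenever `i₁` preserves and `i₂` reverses the orientations
`(o₀, ·)` (`X` connected Hausdorff, `n ≥ 2`): the standard model
`X = α(X ∖ {i₁ 0}) ∪ β(S ∖ {-v})` of `ConnectedSumSphereData.isOpenGluing_connectedSumRel` with
`jA = ι ∘ α`, `jB = ι ∘ β` orientation preserving (Kervaire–Milnor 1963, §2 and Lemma 2.1:
"`Sⁿ` serves as identity element"; Kosinski VI.1.3). [cite: KervaireMilnor1963, §2] -/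
theorem isOrientedConnectedSum_self [ConnectedSpace X] (h2 : 2 ≤ n)
    {o₀ : Orientation ℝ (EuclideanSpace ℝ (Fin n)) (Fin (finrank ℝ (EuclideanSpace ℝ (Fin n))))}
    (oX : SmoothOrientation (𝓡 n) X) (oS : SmoothOrientation (𝓡 n) (sphere (0 : V) 1))
    (h₁ : IsOrientationPreserving (SmoothOrientation.modelSpace o₀) oX D.i₁)
    (h₂ : IsOrientationReversing (SmoothOrientation.modelSpace o₀) oS D.i₂) :
    IsOrientedConnectedSum oX oS oX :=
  ⟨D.i₁, D.i₂, o₀, D.jA, D.jB, D.isSmoothEmbedding_i₁, D.isSmoothEmbedding_i₂, h₁, h₂,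
    ⟨D.isSmoothEmbedding_jA, D.isOpen_range_jA, D.isSmoothEmbedding_jB, D.isOpen_range_jB,
      D.range_jA_union_range_jB, D.jA_eq_jB_iff⟩,
    D.isOrientationPreserving_jA h2 oX, D.isOrientationPreserving_jB h2 h₁ h₂⟩

omit [T2Space X] in
/-- **Oriented standard-model data exist**: for an oriented nonempty `X`, an orientation of the
sphere `S`, a pole `v` and `n ≠ 0`, there are data `(Φ, v, S₀)` whose disc `i₁ = Φ⁻¹` preserves
and whose round disc `i₂ = σᵥ⁻¹ ∘ S₀` reverses the orientations `(o₀, ·)` for a common constant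
orientation `o₀` (choose `o₀` by `i₁`, and `S₀` a reflection if `σᵥ⁻¹` preserves;
Kervaire–Milnor 1963, §2). [cite: KervaireMilnor1963, §2] -/
theorem exists_oriented [Nonempty X] (hn : n ≠ 0) (oX : SmoothOrientation (𝓡 n) X)
    (oS : SmoothOrientation (𝓡 n) (sphere (0 : V) 1)) (v : sphere (0 : V) 1) :
    ∃ (D : ConnectedSumSphereData V n X)
      (o₀ : Orientation ℝ (EuclideanSpace ℝ (Fin n)) (Fin (finrank ℝ (EuclideanSpace ℝ (Fin n))))),
      IsOrientationPreserving (SmoothOrientation.modelSpace o₀) oX D.i₁ ∧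
        IsOrientationReversing (SmoothOrientation.modelSpace o₀) oS D.i₂ := by
  obtain ⟨x⟩ := ‹Nonempty X›
  obtain ⟨e, he, -, het, -⟩ :=
    exists_mem_maximalAtlas_target_eq_univ (E := EuclideanSpace ℝ (Fin n)) x
  have hsymm : ContMDiff (𝓡 n) (𝓡 n) ∞ e.symm := by
    have h := contMDiffOn_symm_of_mem_maximalAtlas he
    rwa [het, contMDiffOn_univ] at h
  set D₀ : ConnectedSumSphereData V n X :=
    ⟨e, het, contMDiffOn_of_mem_maximalAtlas he, hsymm, v, LinearIsometryEquiv.refl ℝ _⟩ with hD₀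
  obtain ⟨o₀, h₁⟩ := exists_isOrientationPreserving_disc
    (D₀.isSmoothEmbedding_i₁ : Manifold.IsSmoothEmbedding 𝓘(ℝ, EuclideanSpace ℝ (Fin n)) (𝓡 n) ∞
      D₀.i₁) (D₀.source_eq ▸ D₀.Φ.open_source) oX
  rcases isOrientationPreserving_or_isOrientationReversing_disc
    (D₀.isSmoothEmbedding_i₂ : Manifold.IsSmoothEmbedding 𝓘(ℝ, EuclideanSpace ℝ (Fin n)) (𝓡 n) ∞
      D₀.i₂) D₀.isOpen_range_i₂ o₀ oS with h | h
  · obtain ⟨R, hR⟩ := exists_linearIsometryEquiv_det_eq_neg_one hn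
    set D : ConnectedSumSphereData V n X :=
      ⟨e, het, contMDiffOn_of_mem_maximalAtlas he, hsymm, v, R⟩ with hD
    refine ⟨D, o₀, h₁, ?_⟩
    have hi₂ : D.i₂ = D₀.i₂ ∘ R := funext fun y => rfl
    rw [hi₂]
    exact isOrientationReversing_disc_comp D₀.isSmoothEmbedding_i₂ D₀.isOpen_range_i₂ h R
      (by rw [hR]; norm_num)
  · exact ⟨D₀, o₀, h₁, h⟩

end ConnectedSumSphereData

/-! ### `M # Sⁿ = M` for oriented connected sums, `n ≥ 2` -/

/-- Local notation: `𝔼 n` is the model Euclidean space `EuclideanSpace ℝ (Fin n)`. -/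
local notation "𝔼 " n:arg => EuclideanSpace ℝ (Fin n)

/-- Local notation: `𝕊 n` is the unit sphere in `EuclideanSpace ℝ (Fin (n + 1))`, the standard
`n`-sphere with its Mathlib analytic manifold structure. -/
local notation "𝕊 " n:arg => (Metric.sphere (0 : EuclideanSpace ℝ (Fin (n + 1))) 1)

universe u

/-- **`M # Sⁿ = M` for oriented connected sums in dimension `n ≥ 2`** — the case `2 ≤ n` of the
named fact `Literature.Topology.FourManifolds.isOrientedConnectedSum_sphere_self` (`HomotopySpheresGroup.lean`; Kervaire–Milnor,
*Groups of homotopy spheres I* (1963), Lemma 2.1, p. 505: "The sphere `Sⁿ` serves as identity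
element"; Kosinski, *Differential Manifolds* (1993), VI.(1.3)): a connected closed oriented smooth
`n`-manifold `(M, oM)`, `n ≥ 2`, is an oriented connected sum of `(M, oM)` and `(𝕊ⁿ, oS)` for
every orientation `oS` of the sphere. Proof: the oriented standard model
(`ConnectedSumSphereData.isOrientedConnectedSum_self`) for data with `i₁` orientation preserving
and the round disc `i₂` orientation reversing (`ConnectedSumSphereData.exists_oriented`).
The case `n = 1` of the fact is not covered here (the argument uses that the punctured pieces are
connected). [cite: KervaireMilnorAnnals1963, Lemma 2.1 (p. 505)] [cite: Kosinski1993, Ch. VI §1 (1.3)] -/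
theorem isOrientedConnectedSum_sphere_self_of_two_le (n : ℕ) (M : Type u) [TopologicalSpace M]
    [T2Space M] [SecondCountableTopology M] [ChartedSpace (𝔼 n) M] [IsManifold (𝓡 n) ∞ M]
    [CompactSpace M] [ConnectedSpace M] (oM : SmoothOrientation (𝓡 n) M)
    (oS : SmoothOrientation (𝓡 n) (𝕊 n)) (h2 : 2 ≤ n) : IsOrientedConnectedSum oM oS oM := by
  haveI : Fact (finrank ℝ (EuclideanSpace ℝ (Fin (n + 1))) = n + 1) := ⟨finrank_euclideanSpace_fin⟩
  obtain ⟨p⟩ : Nonempty (𝕊 n) := (NormedSpace.sphere_nonempty.mpr zero_le_one).to_subtype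
  obtain ⟨D, o₀, h₁, h₂⟩ := ConnectedSumSphereData.exists_oriented (V := 𝔼 (n + 1)) (X := M)
    (by omega) oM oS p
  exact D.isOrientedConnectedSum_self h2 oM oS h₁ h₂

end Literature.Topology.FourManifolds
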